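import Literature.MathematicalPhysics.StatisticalMechanics.LennardJonesClusters
import HarnessLib

/-!
# Yuhjtman's estimates for Lennard-Jones configurations in `ℝ³`: `B ≤ 14.316`, `d_min > 0.684`

Two NAMED FACTS (certified-computation theorems in print; `def … : Prop`, users take `(h : …)`)
from S. A. Yuhjtman, *A sensible estimate for the stability constant of the Lennard-Jones
potential*, J. Stat. Phys. 160 (2015) 1684–1695 = arXiv:1501.05248, transcribed into the
conventions of `Crystallization.lean` / `LennardJonesClusters.lean`:
`lennardJones r = r⁻¹²/12 - r⁻⁶/6` (Blanc–Lewin's normalisation, equilibrium distance `1`,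
minimum `-1/12`), `interactionEnergy V x = ∑_{i<j} V(|xᵢ - xⱼ|)` (each unordered pair once),
`IsGroundState V x` (`x` injective realising the infimum `groundStateEnergy`).

Yuhjtman works with `Φ(r) = r⁻¹² - 2r⁻⁶ = 12 · lennardJones r` (p. 1: "we may assume `A₁ = 1` and
`A₂ = 2` … which attains the global minimum at `1`, and `Φ(1) = -1`"), the SAME length scale, and
defines the stability constant `B` by `(1/|Q|) ∑_{x,y ∈ Q, x ≠ y} Φ(x - y) ≥ -B` for every finite
`Q ⊂ ℝ³` (p. 1), the sum running over UNORDERED pairs (proof of Thm. 9, p. 9: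
"`2 ∑_{x,y∈Q, x≠y} h(‖x-y‖) = ∑_{x₀∈Q} ∑_{y∈Q, y≠x₀} H_{x₀}(y)`"; consistently, the fcc lattice
gives the lower benchmark `B ≥ 8.61`, its energy per particle, de Lima–Procacci–Yuhjtman §5.2 /
[Sch]). Hence, dividing by `12`:

* `Yuhjtman2015_stabilityConstant` — Theorem 9: "Every finite configuration `Q ⊂ ℝ³` satisfies
  `(1/|Q|) ∑_{x≠y} Φ(‖x-y‖) > -14.316`, so the stability constant `B` is at most `14.316`";
  here: for every `N` and every INJECTIVE `x : Fin N → ℝ³`,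
  `∑_{i<j} lennardJones |xᵢ-xⱼ| ≥ -(14.316/12) N` (non-strict, which also covers `N = 0`; the
  printed `>` is for non-empty `Q`). Injectivity is essential: with the real-valued junk
  `lennardJones 0 = 0` a configuration with multiplicities `m` at the points of a negative-energy
  cluster has energy `≈ m² E < -(14.316/12) · m|Q|` for large `m`.
* `Yuhjtman2015_minDistance` — Corollary 7: "An optimal (lowest energy) configuration `Q ⊂ ℝ³` of
  `n` points satisfies `d(x,y) > 0.684 ∀ x,y ∈ Q`" (improving `0.67985` of
  Schachinger–Addis–Bomze–Schoen 2007; p. 2); here: every Lennard-Jones ground state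
  `x : Fin N → ℝ³` (`IsGroundState lennardJones x`) has `dist (x i) (x j) > 0.684` for `i ≠ j`
  (distances are in units of the equilibrium distance in both normalisations).

PROVED consequences: `Yuhjtman2015_minDistance.lennardJonesMinimalDistance` (it sharpens the
tree's qualitative fact `LennardJonesMinimalDistance`, proved there with `δ = 1/3`, to
`δ = 0.684`), `Yuhjtman2015_stabilityConstant.lennardJones_stable_three` (the shape of
`lennardJones_stable` at `d = 3` with the explicit constant) and
`Yuhjtman2015_stabilityConstant.groundStateEnergy_ge` (`E(N) ≥ -(14.316/12) N ≈ -1.193 N`).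

Both facts are computer-assisted but elementary (ball averages of a subharmonic majorant, the
volume bound of Prop. 4, and the one-variable polynomial inequalities of Cor. 7
(`24.05 a⁹ + 2a⁶ ≥ 1` fails for `a ≤ 0.684`) and of the Appendix (`P(d) < 0` on `(0, 0.98]`,
via `R = P' · d⁻¹¹ > 0`)); a sorry-free discharge is plausible but not attempted here (wanted first
as benchmarks by route AtomisticToContinuum/ReggeStarBounds: crux `StabilityConstantTwelve` must
beat `14.316`, and the cell combinatorics may use `δ = 0.684`).

## References

* S. A. Yuhjtman, *A sensible estimate for the stability constant of the Lennard-Jones potential*,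
  J. Stat. Phys. 160 (2015), arXiv:1501.05248: §1 (normalisation, definition of `B`, p. 1–2),
  Prop. 4–6, Cor. 7 (p. 7), Thm. 9 (p. 9), Appendix. [Yuhjtman2015]
* B. N. B. de Lima, A. Procacci, S. Yuhjtman, *On stable pair potentials with an attractive
  tail, remarks on two papers by A. G. Basuev*, Comm. Math. Phys. 343 (2016), §5.2 (fcc benchmark
  `8.61 ≤ B_LJ ≤ 14.316`). [DelimaProcacciYuhjtman2015]
* X. Blanc, M. Lewin, *The crystallization conjecture: a review*, EMS Surv. Math. Sci. 2 (2015),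
  §1.1 (3), §1.3 (10), §2.2. [BlancLewin2015]
-/

noncomputable section

namespace Literature.MathematicalPhysics.StatisticalMechanics

/-- NAMED FACT — **Yuhjtman's bound on the Lennard-Jones stability constant, `B ≤ 14.316`**
(Yuhjtman 2015, Thm. 9: "Let `Φ(x) = ‖x‖⁻¹² - 2‖x‖⁻⁶` be the Lennard-Jones potential. Every finite
configuration `Q ⊂ ℝ³` satisfies `(1/|Q|) ∑_{x,y∈Q, x≠y} Φ(‖x-y‖) > -14.316`, so the stability
constant `B` is at most `14.316`", the sum over unordered pairs). In the tree's normalisation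
`lennardJones = Φ/12`, same length scale: for every `N` and every configuration of `N` DISTINCT
points of `ℝ³`, `∑_{i<j} V_LJ(|xᵢ - xⱼ|) ≥ -(14.316/12) · N`. (Best previous bound `41.66`
[Schachinger et al. 2007]; lower benchmark `8.61` from fcc.) Users take
`(h : Yuhjtman2015_stabilityConstant)`. [cite: Yuhjtman2015, Thm. 9] -/
def Yuhjtman2015_stabilityConstant : Prop :=
  ∀ (N : ℕ) (x : Fin N → EuclideanSpace ℝ (Fin 3)), Function.Injective x →
    -(14.316 / 12 * (N : ℝ)) ≤ interactionEnergy lennardJones x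

/-- NAMED FACT — **Yuhjtman's lower bound `0.684` on the interparticle distance of optimal
Lennard-Jones clusters** (Yuhjtman 2015, Cor. 7: "An optimal (lowest energy) configuration
`Q ⊂ ℝ³` of `n` points satisfies `d(x,y) > 0.684 ∀ x,y ∈ Q`"; improves `0.67985` of
Schachinger–Addis–Bomze–Schoen 2007). In the tree's vocabulary: every Lennard-Jones ground state
of `N` particles in `ℝ³` has all interparticle distances `> 0.684` (equilibrium distance `1`).
Users take `(h : Yuhjtman2015_minDistance)`. [cite: Yuhjtman2015, Cor. 7] -/
def Yuhjtman2015_minDistance : Prop :=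
  ∀ (N : ℕ) (x : Fin N → EuclideanSpace ℝ (Fin 3)), IsGroundState lennardJones x →
    ∀ i j, i ≠ j → (0.684 : ℝ) < dist (x i) (x j)

/-! ## Consequences -/

/-- Yuhjtman's Cor. 7 sharpens the tree's qualitative fact `LennardJonesMinimalDistance` (proved
there with `δ = 1/3`) to `δ = 0.684`. [cite: Yuhjtman2015, Cor. 7] -/
theorem Yuhjtman2015_minDistance.lennardJonesMinimalDistance (h : Yuhjtman2015_minDistance) :
    LennardJonesMinimalDistance :=
  ⟨0.684, by norm_num, fun N x hx i j hij => (h N x hx i j hij).le⟩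

/-- With the explicit witness: `δ = 0.684` works uniformly in `N`. [cite: Yuhjtman2015, Cor. 7] -/
theorem Yuhjtman2015_minDistance.dist_ge (h : Yuhjtman2015_minDistance) {N : ℕ}
    {x : Fin N → EuclideanSpace ℝ (Fin 3)} (hx : IsGroundState lennardJones x) {i j : Fin N}
    (hij : i ≠ j) : (0.684 : ℝ) ≤ dist (x i) (x j) :=
  (h N x hx i j hij).le

/-- Thm. 9 in the shape of `lennardJones_stable` at `d = 3`, with the explicit constant
`C = 14.316/12`. [cite: Yuhjtman2015, Thm. 9] -/
theorem Yuhjtman2015_stabilityConstant.lennardJones_stable_three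
    (h : Yuhjtman2015_stabilityConstant) :
    ∃ C : ℝ, C ≤ 14.316 / 12 ∧ ∀ (N : ℕ) (x : Fin N → EuclideanSpace ℝ (Fin 3)),
      Function.Injective x → -(C * (N : ℝ)) ≤ interactionEnergy lennardJones x :=
  ⟨14.316 / 12, le_rfl, h⟩

/-- Consequently the Lennard-Jones ground-state energy in `ℝ³` satisfies
`E(N) ≥ -(14.316/12) N ≈ -1.193 N` for every `N` (the infimum over the non-empty family of
injective configurations). [cite: Yuhjtman2015, Thm. 9] -/
theorem Yuhjtman2015_stabilityConstant.groundStateEnergy_ge (h : Yuhjtman2015_stabilityConstant)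
    (N : ℕ) : -(14.316 / 12 * (N : ℝ)) ≤ groundStateEnergy lennardJones 3 N := by
  -- an injective configuration of `N` points in `ℝ³` exists: `i ↦ (i : ℝ) • e₀`
  have hne : Nonempty {x : Fin N → EuclideanSpace ℝ (Fin 3) // Function.Injective x} := by
    refine ⟨⟨fun i => ((i : ℕ) : ℝ) • EuclideanSpace.single (0 : Fin 3) (1 : ℝ), ?_⟩⟩
    intro i j hij
    have h1 : ((i : ℕ) : ℝ) • EuclideanSpace.single (0 : Fin 3) (1 : ℝ) 0 =
        ((j : ℕ) : ℝ) • EuclideanSpace.single (0 : Fin 3) (1 : ℝ) 0 := by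
      simpa using congrArg (fun v : EuclideanSpace ℝ (Fin 3) => v 0) hij
    have h2 : ((i : ℕ) : ℝ) = ((j : ℕ) : ℝ) := by simpa using h1
    exact Fin.ext (by exact_mod_cast h2)
  exact le_ciInf fun x => h N x.1 x.2

end Literature.MathematicalPhysics.StatisticalMechanics
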